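import Mathlib
import HarnessLib
import Summits.HubbardSuperconductivity.HubbardSuperconductivity.Theorems.KLProgrammeKLRegimeEngineTwoLegKernelOfConserving
import Summits.HubbardSuperconductivity.HubbardSuperconductivity.Theorems.KLProgrammeKLRegimeEngineScaleWtSliceRows

/-!
# Route `KLProgramme` — crux K3 ENGINE (stmt-HubbardSuperconductivity-20437 `KLRegimeEngineV17F2`), row (b), E1 docket item (2) «(E2)-CELL-READER», part 1:
# the TWO-LEG momentum↔position DICTIONARY at a GENERAL multiplier family, and the bookkeeping of a pinned two-leg cell

Cell `gate-hubbard-kl`, seat hubbard-kl-k3c2-p3 (g19; row «sector-counting import (DR2000 L11/L12) for the leg-dress bar»).  Row (b)'s E1 interface of record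
(pen (R440)(A), FACT-LIST E-198/E-199) carries the d-free family `hE₁`, whose TWO-LEG member (E2) is the input-family CELL
`klWtPinnedSumOf L M β μ (K_n) (i−1) 2 (𝒱_i[K_n]) q w ≤ (s₂u·|U| + s₂c·cc)·4^{−(i−1)}` — the (C1″) cure of the located «(b)-WT4-2LEG-PLAIN-CURRENCY» (this seat, g18).
A producer of (E2) states SYMBOL data (the two-leg symbol `Ŵ₂(k₀, k⃗)` of `𝒱_i[K_n]` and its scaled differences near the Fermi surface, BGM 2006 (2.36)); the cell is a
WEIGHTED position-space `ℓ¹` object.  This file and its sequel `…EngineTwoLegCellReader` are the reader between the two.  Here, model-free: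

* §1 **the dictionary at two legs for a GENERAL family `F`** (the general-family twin of `planeWaveSum_two_eq_charSum_of_conserving`, trivial family, p711656):
  `hubbardPlaneWave_eq_phase_mul_pchar_signed` (either charge: a momentum-independent time phase times a product character at the SIGNED point `∓x̄`),
  **`sectorisedKernel_two_eq_phase_mul_charSum`** — if on the label string `((ω_i,σ_i),c_i)` the `2`-kernel of `T` is conserving-diagonal through the torus images,
  `kernel T 2 ((k_i,σ_i),c_i) = [k̄₀ = k̄₁]·g(k̄₀)`, then `W_{2,Ω}(x) = u_{c₀}(x⁰₀)u_{c₁}(x¹₀)·Σ_Q χ̄_Q(s̄_{c₀}x̄⁰ + s̄_{c₁}x̄¹)·(F_{ω₀}(Q̃)F_{ω₁}(Q̃)g(Q))`, and its norm form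
  `norm_sectorisedKernel_two_eq_norm_charSum`;
* §2 bookkeeping: pinned sums of `2`-tuples (`sum_filter_pin_zero/one_eq_sum_vec`), the pair image (`image_image_vec_two`), the negation symmetry of the
  moment-weighted `ℓ¹` norm (`sum_momentWt_norm_charSum_neg_eq`, weight `w_n(z) = 1 + (Λ_nβ/2M)|z̃₁| + Λ_n|z̃₂,₁| + Λ_n|z̃₂,₂|` of p3's `klScaleWt_pair_latticeLegPos_le`),
  and the two tails `sum_pinned_le_sum_momentWt_of_pos/neg` (`Σ_y W(y)K(y) ≤ Σ_z w_n(z)‖S[G](z)‖` when `W ≤ w_n(x̄−ȳ)`, `K = ‖S[G](±(x̄−ȳ))‖`).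

Everything is proved; no definitions, no named facts; nothing here asserts (E2), any engine row, K3 or superconductivity. [folklore]
References: G. Benfatto, A. Giuliani, V. Mastropietro, Ann. Henri Poincaré 7 (2006) 809–898, §2.3 (2.17), §2.7 (2.70), §2.8 (2.76), (2.81)
[cite: BenfattoGiulianiMastropietro2006]; M. Salmhofer, *Renormalization* (1999) §4.2.4 (4.55)–(4.63).
-/

noncomputable section

namespace Summit.HubbardSuperconductivity.HubbardSuperconductivity.Theorems.TorusFourierL2

set_option linter.dupNamespace false -- summit = problem name (single-conjunct summit), D-0017

open Finset Complex Literature.Probability.LatticeModels Literature.MathematicalPhysics.QuantumLattice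
open Literature.MathematicalPhysics.QuantumLattice.GrassmannAlgebra
open Summit.HubbardSuperconductivity.HubbardSuperconductivity.Theorems.KLRegimeSplit
open Summit.HubbardSuperconductivity.HubbardSuperconductivity.Theorems.KLProgrammeLegKernels
open Summit.HubbardSuperconductivity.HubbardSuperconductivity.Theorems.EngineV8
open scoped Real ComplexConjugate

variable {L M : ℕ} [NeZero L] [NeZero M]

/-! ### §1 The dictionary at two legs for a GENERAL multiplier family -/

/-- **A plane wave of either charge is a momentum-independent time phase times a product character at the SIGNED point**:
`e^{-is_c k·x} = u_c(x₀)·χ̄_{k̄}(s̄_c x̄)` with `s̄_0 x̄ = −x̄` (creator), `s̄_1 x̄ = x̄` (annihilator). [cite: Salmhofer1999, §4.2.4 (4.55)–(4.63)] -/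
theorem hubbardPlaneWave_eq_phase_mul_pchar_signed {β : ℝ} (hβ : β ≠ 0) (c : Fin 2) (k : FreqMomentum L M) (x : SpaceTimeIdx L M) :
    hubbardPlaneWave L M β c k x =
      (if c = 0 then conj (Complex.exp (((π * (1 - 2 * M) * ((x.1 : ℕ) : ℝ) / (2 * M) : ℝ) : ℂ) * I))
        else Complex.exp (((π * (1 - 2 * M) * ((x.1 : ℕ) : ℝ) / (2 * M) : ℝ) : ℂ) * I)) *
        (torusChar (fun _ : Fin 1 => ((k.1 : ℕ) : ZMod (2 * M)))
            (if c = 0 then -(((fun _ : Fin 1 => ((x.1 : ℕ) : ZMod (2 * M))), x.2) : TorusSite 1 (2 * M) × TorusSite 2 L)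
              else (((fun _ : Fin 1 => ((x.1 : ℕ) : ZMod (2 * M))), x.2) : TorusSite 1 (2 * M) × TorusSite 2 L)).1 *
          torusChar k.2
            (if c = 0 then -(((fun _ : Fin 1 => ((x.1 : ℕ) : ZMod (2 * M))), x.2) : TorusSite 1 (2 * M) × TorusSite 2 L)
              else (((fun _ : Fin 1 => ((x.1 : ℕ) : ZMod (2 * M))), x.2) : TorusSite 1 (2 * M) × TorusSite 2 L)).2) := by
  fin_cases c
  · simp only [Fin.zero_eta, Fin.isValue, if_true, Prod.fst_neg, Prod.snd_neg]
    exact hubbardPlaneWave_zero_eq_phase_mul_pchar hβ k x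
  · simp only [Fin.mk_one, Fin.isValue, one_ne_zero, if_false]
    exact hubbardPlaneWave_one_eq_phase_mul_pchar hβ k x

omit [NeZero L] [NeZero M] in
/-- The time phases are unimodular. [folklore] -/
theorem norm_timePhase_signed (c : Fin 2) (x : SpaceTimeIdx L M) :
    ‖(if c = 0 then conj (Complex.exp (((π * (1 - 2 * M) * ((x.1 : ℕ) : ℝ) / (2 * M) : ℝ) : ℂ) * I))
        else Complex.exp (((π * (1 - 2 * M) * ((x.1 : ℕ) : ℝ) / (2 * M) : ℝ) : ℂ) * I))‖ = 1 := by
  split_ifs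
  · rw [Complex.norm_conj, Complex.norm_exp_ofReal_mul_I]
  · rw [Complex.norm_exp_ofReal_mul_I]

omit [NeZero L] in
/-- **Round trip**: the frequency–momentum with torus image `k̄` is `k` (`(k̄)˜ = k`). [folklore] -/
theorem freqMomentum_of_bar (k : FreqMomentum L M) :
    ((⟨((((k.1 : ℕ) : ZMod (2 * M))) : ZMod (2 * M)).val, ZMod.val_lt _⟩, k.2) : FreqMomentum L M) = k := by
  refine Prod.ext ?_ rfl
  exact Fin.ext (val_natCast_matsubaraIdx k.1)


/-- **THE TWO-LEG DICTIONARY FOR A GENERAL MULTIPLIER FAMILY.**  For a family `F` of `N` multipliers, a Grassmann element `T` and a label string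
`((ω_i, σ_i), c_i)_{i<2}` on which the `2`-kernel of `T` is CONSERVING-DIAGONAL through the torus images, `kernel T 2 ((k_i,σ_i),c_i) = [k̄₀ = k̄₁]·g(k̄₀)`,
the sectorised kernel is a time phase times ONE product-torus character sum at the signed point `s̄_{c₀}x̄⁰ + s̄_{c₁}x̄¹`:
`W_{2,Ω}(x) = u_{c₀}(x⁰₀)·u_{c₁}(x¹₀)·Σ_Q χ̄_Q(s̄_{c₀}x̄⁰ + s̄_{c₁}x̄¹)·(F_{ω₀}(Q̃)·F_{ω₁}(Q̃)·g(Q))` (`Q̃` the frequency–momentum with image `Q`) — the general-family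
twin of `planeWaveSum_two_eq_charSum_of_conserving` (trivial family). [cite: BenfattoGiulianiMastropietro2006, §2.7 (2.70)] -/
theorem sectorisedKernel_two_eq_phase_mul_charSum {N : ℕ} {β : ℝ} (hβ : β ≠ 0) (F : Fin N → FreqMomentum L M → ℂ) (T : HubbardGrassmann L M)
    (σ c : Fin 2 → Fin 2) (g : TorusSite 1 (2 * M) × TorusSite 2 L → ℂ)
    (hker : ∀ k : Fin 2 → FreqMomentum L M, kernel ℂ T 2 (fun i => ((k i, σ i), c i)) =
      if ((fun _ : Fin 1 => (((k 0).1 : ℕ) : ZMod (2 * M))), (k 0).2) = (((fun _ : Fin 1 => (((k 1).1 : ℕ) : ZMod (2 * M))), (k 1).2) : TorusSite 1 (2 * M) × TorusSite 2 L)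
      then g ((fun _ : Fin 1 => (((k 0).1 : ℕ) : ZMod (2 * M))), (k 0).2) else 0)
    (ω : Fin 2 → Fin N) (x : Fin 2 → SpaceTimeIdx L M) :
    sectorisedKernel L M β F T 2 (fun i => ((ω i, σ i), c i)) x =
      ((if c 0 = 0 then conj (Complex.exp (((π * (1 - 2 * M) * (((x 0).1 : ℕ) : ℝ) / (2 * M) : ℝ) : ℂ) * I))
          else Complex.exp (((π * (1 - 2 * M) * (((x 0).1 : ℕ) : ℝ) / (2 * M) : ℝ) : ℂ) * I)) *
        (if c 1 = 0 then conj (Complex.exp (((π * (1 - 2 * M) * (((x 1).1 : ℕ) : ℝ) / (2 * M) : ℝ) : ℂ) * I))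
          else Complex.exp (((π * (1 - 2 * M) * (((x 1).1 : ℕ) : ℝ) / (2 * M) : ℝ) : ℂ) * I))) *
      ∑ Q : TorusSite 1 (2 * M) × TorusSite 2 L,
        (torusChar Q.1
            ((if c 0 = 0 then -(((fun _ : Fin 1 => (((x 0).1 : ℕ) : ZMod (2 * M))), (x 0).2) : TorusSite 1 (2 * M) × TorusSite 2 L)
              else (((fun _ : Fin 1 => (((x 0).1 : ℕ) : ZMod (2 * M))), (x 0).2) : TorusSite 1 (2 * M) × TorusSite 2 L)) +
            (if c 1 = 0 then -(((fun _ : Fin 1 => (((x 1).1 : ℕ) : ZMod (2 * M))), (x 1).2) : TorusSite 1 (2 * M) × TorusSite 2 L)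
              else (((fun _ : Fin 1 => (((x 1).1 : ℕ) : ZMod (2 * M))), (x 1).2) : TorusSite 1 (2 * M) × TorusSite 2 L))).1 *
          torusChar Q.2
            ((if c 0 = 0 then -(((fun _ : Fin 1 => (((x 0).1 : ℕ) : ZMod (2 * M))), (x 0).2) : TorusSite 1 (2 * M) × TorusSite 2 L)
              else (((fun _ : Fin 1 => (((x 0).1 : ℕ) : ZMod (2 * M))), (x 0).2) : TorusSite 1 (2 * M) × TorusSite 2 L)) +
            (if c 1 = 0 then -(((fun _ : Fin 1 => (((x 1).1 : ℕ) : ZMod (2 * M))), (x 1).2) : TorusSite 1 (2 * M) × TorusSite 2 L)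
              else (((fun _ : Fin 1 => (((x 1).1 : ℕ) : ZMod (2 * M))), (x 1).2) : TorusSite 1 (2 * M) × TorusSite 2 L))).2) *
          (F (ω 0) (⟨(Q.1 0).val, ZMod.val_lt (Q.1 0)⟩, Q.2) * F (ω 1) (⟨(Q.1 0).val, ZMod.val_lt (Q.1 0)⟩, Q.2) * g Q) := by
  classical
  -- abbreviations
  set u : Fin 2 → ℂ := fun i => if c i = 0 then conj (Complex.exp (((π * (1 - 2 * M) * (((x i).1 : ℕ) : ℝ) / (2 * M) : ℝ) : ℂ) * I))
    else Complex.exp (((π * (1 - 2 * M) * (((x i).1 : ℕ) : ℝ) / (2 * M) : ℝ) : ℂ) * I) with hu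
  set a : Fin 2 → TorusSite 1 (2 * M) × TorusSite 2 L := fun i =>
    if c i = 0 then -(((fun _ : Fin 1 => (((x i).1 : ℕ) : ZMod (2 * M))), (x i).2) : TorusSite 1 (2 * M) × TorusSite 2 L)
    else (((fun _ : Fin 1 => (((x i).1 : ℕ) : ZMod (2 * M))), (x i).2) : TorusSite 1 (2 * M) × TorusSite 2 L) with ha
  -- the summand as a function of the torus images
  set Φ : (TorusSite 1 (2 * M) × TorusSite 2 L) → (TorusSite 1 (2 * M) × TorusSite 2 L) → ℂ := fun p₀ p₁ =>
    (F (ω 0) (⟨(p₀.1 0).val, ZMod.val_lt (p₀.1 0)⟩, p₀.2) * (u 0 * (torusChar p₀.1 (a 0).1 * torusChar p₀.2 (a 0).2))) *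
      (F (ω 1) (⟨(p₁.1 0).val, ZMod.val_lt (p₁.1 0)⟩, p₁.2) * (u 1 * (torusChar p₁.1 (a 1).1 * torusChar p₁.2 (a 1).2))) *
      (if p₀ = p₁ then g p₀ else 0) with hΦ
  have hterm : ∀ k : Fin 2 → FreqMomentum L M,
      (∏ i, F ((fun i => (((ω i, σ i) : Fin N × Fin 2), c i)) i).1.1 (k i) * hubbardPlaneWave L M β ((fun i => (((ω i, σ i) : Fin N × Fin 2), c i)) i).2 (k i) (x i)) *
        kernel ℂ T 2 (fun i => ((k i, ((fun i => (((ω i, σ i) : Fin N × Fin 2), c i)) i).1.2), ((fun i => (((ω i, σ i) : Fin N × Fin 2), c i)) i).2)) =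
      Φ ((fun _ : Fin 1 => (((k 0).1 : ℕ) : ZMod (2 * M))), (k 0).2) ((fun _ : Fin 1 => (((k 1).1 : ℕ) : ZMod (2 * M))), (k 1).2) := by
    intro k
    have hk : kernel ℂ T 2 (fun i => ((k i, ((fun i => (((ω i, σ i) : Fin N × Fin 2), c i)) i).1.2), ((fun i => (((ω i, σ i) : Fin N × Fin 2), c i)) i).2)) =
        kernel ℂ T 2 (fun i => ((k i, σ i), c i)) := rfl
    rw [hk, hker k, Fin.prod_univ_two]
    simp only
    rw [hubbardPlaneWave_eq_phase_mul_pchar_signed hβ (c 0) (k 0) (x 0), hubbardPlaneWave_eq_phase_mul_pchar_signed hβ (c 1) (k 1) (x 1)]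
    simp only [hΦ, hu, ha, freqMomentum_of_bar]
  rw [sectorisedKernel_def]
  rw [Finset.sum_congr rfl fun k _ => hterm k]
  rw [sum_tuple2_freqMomentum_eq Φ]
  -- the second leg is forced
  have hin : ∀ p₀ : TorusSite 1 (2 * M) × TorusSite 2 L, ∑ p₁ : TorusSite 1 (2 * M) × TorusSite 2 L, Φ p₀ p₁ =
      (u 0 * u 1) * ((torusChar p₀.1 (a 0 + a 1).1 * torusChar p₀.2 (a 0 + a 1).2) *
        (F (ω 0) (⟨(p₀.1 0).val, ZMod.val_lt (p₀.1 0)⟩, p₀.2) * F (ω 1) (⟨(p₀.1 0).val, ZMod.val_lt (p₀.1 0)⟩, p₀.2) * g p₀)) := by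
    intro p₀
    simp only [hΦ, mul_ite, mul_zero]
    rw [Finset.sum_ite_eq univ p₀, if_pos (mem_univ _), pchar_add_right']
    ring
  simp_rw [hin]
  rw [← Finset.mul_sum]

/-- **Norm form of the dictionary**: `‖W_{2,Ω}(x)‖ = ‖Σ_Q χ̄_Q(s̄_{c₀}x̄⁰ + s̄_{c₁}x̄¹)•(F_{ω₀}F_{ω₁}g)(Q)‖` (the phases are unimodular).
[cite: BenfattoGiulianiMastropietro2006, §2.7 (2.70)] -/
theorem norm_sectorisedKernel_two_eq_norm_charSum {N : ℕ} {β : ℝ} (hβ : β ≠ 0) (F : Fin N → FreqMomentum L M → ℂ) (T : HubbardGrassmann L M)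
    (σ c : Fin 2 → Fin 2) (g : TorusSite 1 (2 * M) × TorusSite 2 L → ℂ)
    (hker : ∀ k : Fin 2 → FreqMomentum L M, kernel ℂ T 2 (fun i => ((k i, σ i), c i)) =
      if ((fun _ : Fin 1 => (((k 0).1 : ℕ) : ZMod (2 * M))), (k 0).2) = (((fun _ : Fin 1 => (((k 1).1 : ℕ) : ZMod (2 * M))), (k 1).2) : TorusSite 1 (2 * M) × TorusSite 2 L)
      then g ((fun _ : Fin 1 => (((k 0).1 : ℕ) : ZMod (2 * M))), (k 0).2) else 0)
    (ω : Fin 2 → Fin N) (x : Fin 2 → SpaceTimeIdx L M) :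
    ‖sectorisedKernel L M β F T 2 (fun i => ((ω i, σ i), c i)) x‖ =
      ‖∑ Q : TorusSite 1 (2 * M) × TorusSite 2 L,
        (torusChar Q.1
            ((if c 0 = 0 then -(((fun _ : Fin 1 => (((x 0).1 : ℕ) : ZMod (2 * M))), (x 0).2) : TorusSite 1 (2 * M) × TorusSite 2 L)
              else (((fun _ : Fin 1 => (((x 0).1 : ℕ) : ZMod (2 * M))), (x 0).2) : TorusSite 1 (2 * M) × TorusSite 2 L)) +
            (if c 1 = 0 then -(((fun _ : Fin 1 => (((x 1).1 : ℕ) : ZMod (2 * M))), (x 1).2) : TorusSite 1 (2 * M) × TorusSite 2 L)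
              else (((fun _ : Fin 1 => (((x 1).1 : ℕ) : ZMod (2 * M))), (x 1).2) : TorusSite 1 (2 * M) × TorusSite 2 L))).1 *
          torusChar Q.2
            ((if c 0 = 0 then -(((fun _ : Fin 1 => (((x 0).1 : ℕ) : ZMod (2 * M))), (x 0).2) : TorusSite 1 (2 * M) × TorusSite 2 L)
              else (((fun _ : Fin 1 => (((x 0).1 : ℕ) : ZMod (2 * M))), (x 0).2) : TorusSite 1 (2 * M) × TorusSite 2 L)) +
            (if c 1 = 0 then -(((fun _ : Fin 1 => (((x 1).1 : ℕ) : ZMod (2 * M))), (x 1).2) : TorusSite 1 (2 * M) × TorusSite 2 L)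
              else (((fun _ : Fin 1 => (((x 1).1 : ℕ) : ZMod (2 * M))), (x 1).2) : TorusSite 1 (2 * M) × TorusSite 2 L))).2) •
          (F (ω 0) (⟨(Q.1 0).val, ZMod.val_lt (Q.1 0)⟩, Q.2) * F (ω 1) (⟨(Q.1 0).val, ZMod.val_lt (Q.1 0)⟩, Q.2) * g Q)‖ := by
  rw [sectorisedKernel_two_eq_phase_mul_charSum hβ F T σ c g hker ω x, norm_mul, norm_mul, norm_timePhase_signed, norm_timePhase_signed,
    one_mul, one_mul]
  simp only [smul_eq_mul]


/-! ### §2 Bookkeeping: pinned sums of `2`-tuples, the pair image, the moment weight -/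

omit [NeZero L] [NeZero M] in
/-- Re-indexing the pinned sum at leg `0` of a `2`-tuple over any finite type: `Σ_{X : X 0 = a} Φ X = Σ_b Φ ![a, b]`. [folklore] -/
theorem sum_filter_pin_zero_eq_sum_vec {α E : Type*} [Fintype α] [DecidableEq α] [AddCommMonoid E] (a : α) (Φ : (Fin 2 → α) → E) :
    ∑ X ∈ univ.filter (fun X : Fin 2 → α => X 0 = a), Φ X = ∑ b : α, Φ ![a, b] := by
  classical
  refine Finset.sum_bij' (fun X _ => X 1) (fun b _ => ![a, b]) ?_ ?_ ?_ ?_ ?_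
  · intro X _; exact mem_univ _
  · intro b _; simp
  · intro X hX
    simp only [mem_filter, mem_univ, true_and] at hX
    funext i; fin_cases i
    · simpa using hX.symm
    · simp
  · intro b _; simp
  · intro X hX
    simp only [mem_filter, mem_univ, true_and] at hX
    congr 1; funext i; fin_cases i
    · simpa using hX
    · simp

omit [NeZero L] [NeZero M] in
/-- Re-indexing the pinned sum at leg `1` of a `2`-tuple: `Σ_{X : X 1 = a} Φ X = Σ_b Φ ![b, a]`. [folklore] -/
theorem sum_filter_pin_one_eq_sum_vec {α E : Type*} [Fintype α] [DecidableEq α] [AddCommMonoid E] (a : α) (Φ : (Fin 2 → α) → E) :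
    ∑ X ∈ univ.filter (fun X : Fin 2 → α => X 1 = a), Φ X = ∑ b : α, Φ ![b, a] := by
  classical
  refine Finset.sum_bij' (fun X _ => X 0) (fun b _ => ![b, a]) ?_ ?_ ?_ ?_ ?_
  · intro X _; exact mem_univ _
  · intro b _; simp
  · intro X hX
    simp only [mem_filter, mem_univ, true_and] at hX
    funext i; fin_cases i
    · simp
    · simpa using hX.symm
  · intro b _; simp
  · intro X hX
    simp only [mem_filter, mem_univ, true_and] at hX
    congr 1; funext i; fin_cases i
    · simp
    · simpa using hX

omit [NeZero L] [NeZero M] in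
/-- The image of a `2`-tuple is the pair of its values. [folklore] -/
theorem image_image_vec_two {α γ : Type*} [DecidableEq α] [DecidableEq γ] (a b : α) (f : α → γ) :
    ((univ : Finset (Fin 2)).image ![a, b]).image f = {f a, f b} := by
  ext z
  simp only [mem_image, mem_univ, true_and, Fin.exists_fin_two, Matrix.cons_val_zero, Matrix.cons_val_one, mem_insert,
    mem_singleton]
  constructor
  · rintro ⟨y, (rfl | rfl), rfl⟩
    · exact Or.inl rfl
    · exact Or.inr rfl
  · rintro (rfl | rfl)
    · exact ⟨a, Or.inl rfl, rfl⟩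
    · exact ⟨b, Or.inr rfl, rfl⟩

/-- **Negation symmetry of the weighted `ℓ¹` norm**: with the (even) moment weight, `Σ_z w(z)‖S[G](−z)‖ = Σ_z w(z)‖S[G](z)‖`. [folklore] -/
theorem sum_momentWt_norm_charSum_neg_eq (s₀ s₁ : ℝ) (G : TorusSite 1 (2 * M) × TorusSite 2 L → ℂ) :
    ∑ z : TorusSite 1 (2 * M) × TorusSite 2 L,
        (1 + s₀ * |(((z.1 0).valMinAbs : ℤ) : ℝ)| + s₁ * |(((z.2 0).valMinAbs : ℤ) : ℝ)| + s₁ * |(((z.2 1).valMinAbs : ℤ) : ℝ)|) *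
          ‖∑ Q : TorusSite 1 (2 * M) × TorusSite 2 L, (torusChar Q.1 (-z).1 * torusChar Q.2 (-z).2) • G Q‖ =
      ∑ z : TorusSite 1 (2 * M) × TorusSite 2 L,
        (1 + s₀ * |(((z.1 0).valMinAbs : ℤ) : ℝ)| + s₁ * |(((z.2 0).valMinAbs : ℤ) : ℝ)| + s₁ * |(((z.2 1).valMinAbs : ℤ) : ℝ)|) *
          ‖∑ Q : TorusSite 1 (2 * M) × TorusSite 2 L, (torusChar Q.1 z.1 * torusChar Q.2 z.2) • G Q‖ := by
  haveI : NeZero (2 * M) := ⟨by have := NeZero.ne M; omega⟩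
  refine Fintype.sum_equiv (Equiv.neg _) _ _ fun z => ?_
  simp only [Equiv.neg_apply, Prod.fst_neg, Prod.snd_neg]
  rw [momentWt_neg s₀ s₁ z.1 z.2]


/-- **Tail of the pinned sum, direct sign**: if pointwise `W(y) ≤ w_n(x̄ − ȳ)` and `K(y) = ‖S[G](x̄ − ȳ)‖`, then `Σ_y W(y)·K(y) ≤ Σ_z w_n(z)·‖S[G](z)‖`. [folklore] -/
theorem sum_pinned_le_sum_momentWt_of_pos (β : ℝ) (n : ℕ) (x : SpaceTimeIdx L M) (G : TorusSite 1 (2 * M) × TorusSite 2 L → ℂ)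
    (W K : SpaceTimeIdx L M → ℝ)
    (hW : ∀ y, W y ≤ 1 + klScale klE0 n * β / (2 * M) * |(((((x.1 : ℕ) : ZMod (2 * M)) - ((y.1 : ℕ) : ZMod (2 * M))).valMinAbs : ℤ) : ℝ)| +
        klScale klE0 n * |((((x.2 - y.2) 0).valMinAbs : ℤ) : ℝ)| + klScale klE0 n * |((((x.2 - y.2) 1).valMinAbs : ℤ) : ℝ)|)
    (hK : ∀ y, K y = ‖∑ Q : TorusSite 1 (2 * M) × TorusSite 2 L,
        (torusChar Q.1 ((((fun _ : Fin 1 => ((x.1 : ℕ) : ZMod (2 * M)) - ((y.1 : ℕ) : ZMod (2 * M))), x.2 - y.2) : TorusSite 1 (2 * M) × TorusSite 2 L)).1 *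
          torusChar Q.2 ((((fun _ : Fin 1 => ((x.1 : ℕ) : ZMod (2 * M)) - ((y.1 : ℕ) : ZMod (2 * M))), x.2 - y.2) : TorusSite 1 (2 * M) × TorusSite 2 L)).2) • G Q‖) :
    ∑ y : SpaceTimeIdx L M, W y * K y ≤
      ∑ z : TorusSite 1 (2 * M) × TorusSite 2 L,
        (1 + klScale klE0 n * β / (2 * M) * |(((z.1 0).valMinAbs : ℤ) : ℝ)| + klScale klE0 n * |(((z.2 0).valMinAbs : ℤ) : ℝ)| +
            klScale klE0 n * |(((z.2 1).valMinAbs : ℤ) : ℝ)|) *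
          ‖∑ Q : TorusSite 1 (2 * M) × TorusSite 2 L, (torusChar Q.1 z.1 * torusChar Q.2 z.2) • G Q‖ := by
  set h : TorusSite 1 (2 * M) × TorusSite 2 L → ℝ := fun z =>
    (1 + klScale klE0 n * β / (2 * M) * |(((z.1 0).valMinAbs : ℤ) : ℝ)| + klScale klE0 n * |(((z.2 0).valMinAbs : ℤ) : ℝ)| +
        klScale klE0 n * |(((z.2 1).valMinAbs : ℤ) : ℝ)|) *
      ‖∑ Q : TorusSite 1 (2 * M) × TorusSite 2 L, (torusChar Q.1 z.1 * torusChar Q.2 z.2) • G Q‖ with hh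
  have hre := sum_spaceTime_eq_sum_prodTorus h x
  rw [← hre]
  refine Finset.sum_le_sum fun y _ => ?_
  rw [hK y]
  exact mul_le_mul_of_nonneg_right (hW y) (norm_nonneg _)

/-- **Tail of the pinned sum, reflected sign**: if pointwise `W(y) ≤ w_n(x̄ − ȳ)` and `K(y) = ‖S[G](−(x̄ − ȳ))‖`, then `Σ_y W(y)·K(y) ≤ Σ_z w_n(z)·‖S[G](z)‖`
(the moment weight is even). [folklore] -/
theorem sum_pinned_le_sum_momentWt_of_neg (β : ℝ) (n : ℕ) (x : SpaceTimeIdx L M) (G : TorusSite 1 (2 * M) × TorusSite 2 L → ℂ)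
    (W K : SpaceTimeIdx L M → ℝ)
    (hW : ∀ y, W y ≤ 1 + klScale klE0 n * β / (2 * M) * |(((((x.1 : ℕ) : ZMod (2 * M)) - ((y.1 : ℕ) : ZMod (2 * M))).valMinAbs : ℤ) : ℝ)| +
        klScale klE0 n * |((((x.2 - y.2) 0).valMinAbs : ℤ) : ℝ)| + klScale klE0 n * |((((x.2 - y.2) 1).valMinAbs : ℤ) : ℝ)|)
    (hK : ∀ y, K y = ‖∑ Q : TorusSite 1 (2 * M) × TorusSite 2 L,
        (torusChar Q.1 (-(((fun _ : Fin 1 => ((x.1 : ℕ) : ZMod (2 * M)) - ((y.1 : ℕ) : ZMod (2 * M))), x.2 - y.2) : TorusSite 1 (2 * M) × TorusSite 2 L)).1 *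
          torusChar Q.2 (-(((fun _ : Fin 1 => ((x.1 : ℕ) : ZMod (2 * M)) - ((y.1 : ℕ) : ZMod (2 * M))), x.2 - y.2) : TorusSite 1 (2 * M) × TorusSite 2 L)).2) • G Q‖) :
    ∑ y : SpaceTimeIdx L M, W y * K y ≤
      ∑ z : TorusSite 1 (2 * M) × TorusSite 2 L,
        (1 + klScale klE0 n * β / (2 * M) * |(((z.1 0).valMinAbs : ℤ) : ℝ)| + klScale klE0 n * |(((z.2 0).valMinAbs : ℤ) : ℝ)| +
            klScale klE0 n * |(((z.2 1).valMinAbs : ℤ) : ℝ)|) *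
          ‖∑ Q : TorusSite 1 (2 * M) × TorusSite 2 L, (torusChar Q.1 z.1 * torusChar Q.2 z.2) • G Q‖ := by
  set h : TorusSite 1 (2 * M) × TorusSite 2 L → ℝ := fun z =>
    (1 + klScale klE0 n * β / (2 * M) * |(((z.1 0).valMinAbs : ℤ) : ℝ)| + klScale klE0 n * |(((z.2 0).valMinAbs : ℤ) : ℝ)| +
        klScale klE0 n * |(((z.2 1).valMinAbs : ℤ) : ℝ)|) *
      ‖∑ Q : TorusSite 1 (2 * M) × TorusSite 2 L, (torusChar Q.1 (-z).1 * torusChar Q.2 (-z).2) • G Q‖ with hh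
  have hre := sum_spaceTime_eq_sum_prodTorus h x
  rw [← sum_momentWt_norm_charSum_neg_eq, ← hre]
  refine Finset.sum_le_sum fun y _ => ?_
  rw [hK y]
  exact mul_le_mul_of_nonneg_right (hW y) (norm_nonneg _)

end Summit.HubbardSuperconductivity.HubbardSuperconductivity.Theorems.TorusFourierL2

end
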